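import Summits.QuantumFields.YangMills.Theorems.UnitScaleTiltProp8HalvingA1Row165TraceSU2
import Summits.QuantumFields.YangMills.Theorems.UnitScaleTiltFlatPortAllSizesAllL
import HarnessLib

/-!
# Route `UnitScaleTilt`, crux K1 child «MinimiserStabilityRegPr» (stmt-QuantumFields-19200), registered stub `stub_halvingStep` (H), branch **(P2-small)**,
# mechanism (α) COVERING ∕ PERIODISATION (OWNER RULING g26-№18, ACK 36, ACK 38) — file **α8 `HalvingA1Row165AllSizesAllL`** (= ✓α7 `HalvingA1Row165AllSizes` with the binder `(hℓ : 4 ≤ ℓ)` deleted, suppliers ✓`FlatPortAllSizesAllL`):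
# **THE (165)-A₁ ROW AT THE CUBE SEQUENCE AT EVERY TORUS SIZE** — ✓`HalvingA1Row165L5.row165_L5`, ✓`HalvingA1Row165TraceL5.row165_of_tracePairing_L5` and
# ✓`HalvingA1Row165TraceSU2.row165_of_tracePairing_L5_su2` VERBATIM with the single binder `(_ : a′ + 3 ≤ m + n)` DELETED, the P2 suppliers
# ✓`FlatPortBodyL0.body_of_adm22` (P-1) ∕ ✓`FlatPortGBandL0.gBand_of_adm22` (P-2) swapped for ★✓`FlatPortAllSizes.body_of_adm22_allSizes` ∕ ★✓`gBand_of_adm22_allSizes`.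

Cell `ym3-torus` (HUMAN RULING D-0037, YM ladder rung R3 — continuum SU(2) YM₃ on the torus is a RUNG, not the Clay problem), explicit-unit helper seat
`ym-ust-19200-w7` gen 0.  `--supports stmt-QuantumFields-19200 --as helper`; count-neutral; def-free, 0 sorry, standard axioms.  The three proofs are the ✓L5 proofs with
`hsize` deleted (pure supplier swaps): ★`row165_allSizes` → ★`row165_of_tracePairing_allSizes` → ★★`row165_of_tracePairing_su2_allSizes` (the (165)-A₁ supplier of the
chain of record `pkg.hcrit → hmin_of_hcrit → tracePairing_of_isMinOn_dressed_wilson_su2 → row165_of_tracePairing_…_su2`, now at every torus size).  HONEST SCOPE: (P2-L3)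
`L = 3` remains a Literature-side debt (WANTED №g26-4); the H stub, the crux, the rung and the mass gap are NOT touched.

References: T. Bałaban, CMP **102** (1985) 277–309 [Balaban1985Variational] (99)–(100) p.293, (126)–(133) pp.297–298, (144) p.300, (152)–(153) p.301, (158) p.302,
(165) p.304; CMP **96** (1984) 223–250 [Balaban1984PropagatorsII] (2.1)–(2.3) p.224, (2.16) p.225, Prop. 2.6 (2.136) p.247, Cor. 2.8 (2.150)–(2.151) p.249.
-/

set_option autoImplicit false

noncomputable section

open scoped BigOperators InnerProductSpace Matrix Matrix.Norms.L2Operator ComplexConjugate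

namespace Summit.QuantumFields.YangMills.Theorems.HalvingA1Row165AllSizesAllL

open Literature.MathematicalPhysics.QuantumFieldTheory.Balaban1983to89
open B6GlobalChartV1 (PV)
open B6SectADomainsV1 (Domains)
open B6SectAOperatorsV1 (BondIdx RE dsE)
open B8Ineq132 (BondTouches)
open B8Eq140Level (SideTouches)
open B8Eq143PlaqExpansion (pdiv)
open B8Eq146AExpansion (plaqCovDeriv)
open B8Thm2SetupTorus (pullDom)
open B10Eq27TorusAxialLog (pull transl)
open T3ContinuumYM3Torus (T3Family)
open FlatCubeOpsText (Adm22 IsLevWeight IsFlatGt GtSupLetterG)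
open FlatCubeSequenceAligned (cubeSeqMT3)
open FlatCubeSequenceAdm (adm22_cubeSeqMT3)
open FlatCubeQContraction (qContrLetter_of_adm22)
open HalvingA1Row165EL (row165_of_slice)
open B6SectAOperatorsV1 (BondIdx QE RE dsE)
open LatticeFieldCalculus (bondAvgIter)
open FlatCubeOpsText (IsLevWeight)
open FlatOpsLettersAssembly (flatH)
open HalvingELTracePairing (sol158_of_tracePairing)
open HalvingA1Row165TraceAnyW (re_trace_antiHerm_mul_selfAdjoint re_trace_mul_eq_hermPart isSelfAdjoint_hermPart norm_hermPart_le)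
open FlatPlaqDeriv (norm_trace_le_two_mul)
open HalvingA1Row165TraceSU2 (trace_sub_halfTrace isSelfAdjoint_sub_halfTrace norm_sub_halfTrace_le re_trace_sub_halfTrace_mul trace_mul_smul_smul_one_eq_zero)
open FlatPortAllSizesAllL (body_of_adm22_allSizes_allL gBand_of_adm22_allSizes_allL)

/-- `1 ≤ 3` (named once). [folklore] -/
private theorem hd3 : 1 ≤ 2 + 1 := by norm_num

/-- ★ **THE (165)-A₁ ROW AT THE CUBE SEQUENCE, P2 SIDE DISCHARGED, EVERY ODD `L ≥ 3`, EVERY TORUS SIZE** (✓`row165_L5` with the binder `a′ + 3 ≤ m + n` deleted; suppliers `body_of_adm22_allSizes`, `gBand_of_adm22_allSizes`) — see the module docstring for the binder list; the conclusion is LITERALLY the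
(165)-A₁ clause of `HalvingAssembly.H_of_package`∕`HalvingAssemblyInterior.H_of_packageInt` (= that of `HalvingA1Row165.row165_of_smallSolution_layer`) with bound `e`.
[cite: Balaban1985Variational, (131)-(133) p.298, (152)-(153) p.301, (158) p.302, (165) p.304; Balaban1984PropagatorsII, (2.1)-(2.2) p.224, Prop. 2.6 (2.136) p.247, Cor. 2.8 (2.150)-(2.151) p.249] -/
theorem row165_allSizes_allL (ℓ : ℕ) (hL : Odd (ℓ + 1) ∧ 1 < ℓ + 1) :
    ∃ (Mh₀ R₀ : ℕ) (B₀ BM : ℝ), 0 ≤ B₀ ∧ 0 ≤ BM ∧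
    ∀ (m : ℕ) (hm : 1 ≤ m) (n K : ℕ) (_ : 1 ≤ K - n) (_ : K - n + 1 ≤ m + K) {Mh R a' : ℕ} (_ : Mh = (ℓ + 1) ^ a') (_ : Mh₀ ≤ Mh) (_ : R₀ ≤ R)
      (hM1 : 1 ≤ (ℓ + 1) * Mh) (x₀ : Site (PV 2 ℓ m K hd3 hL) 0) (ρ S : ℕ) (_ : R * ((ℓ + 1) * Mh) ≤ S) (_ : 1 ≤ ρ)
      (w : ℕ → PBond (PV 2 ℓ m K hd3 hL) 0 → ℝ)
      (_ : IsLevWeight (⟨ℓ + 1, hL, m, hm⟩ : T3Family) n K (cubeSeqMT3 (⟨ℓ + 1, hL, m, hm⟩ : T3Family) n K x₀ ρ S ((ℓ + 1) * Mh) hM1) w),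
      ∃ Gt : (PBond (PV 2 ℓ m K hd3 hL) 0 → ℝ) →ₗ[ℝ] (PBond (PV 2 ℓ m K hd3 hL) 0 → ℝ),
        IsFlatGt (⟨ℓ + 1, hL, m, hm⟩ : T3Family) n K (cubeSeqMT3 (⟨ℓ + 1, hL, m, hm⟩ : T3Family) n K x₀ ρ S ((ℓ + 1) * Mh) hM1) Gt ∧
        GtSupLetterG (⟨ℓ + 1, hL, m, hm⟩ : T3Family) n K w Gt B₀ ∧
        ∀ (G : (PBond (PV 2 ℓ m K hd3 hL) 0 → Matrix (Fin 2) (Fin 2) ℂ) →ₗ[ℂ] (PBond (PV 2 ℓ m K hd3 hL) 0 → Matrix (Fin 2) (Fin 2) ℂ))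
          (_ : ∀ (f : PBond (PV 2 ℓ m K hd3 hL) 0 → Matrix (Fin 2) (Fin 2) ℂ) (b : PBond (PV 2 ℓ m K hd3 hL) 0), G f b = ∑ b', Gt (Pi.single b' 1) b • f b')
          (W : (PBond (PV 2 ℓ m K hd3 hL) 0 → Matrix (Fin 2) (Fin 2) ℂ) → (PBond (PV 2 ℓ m K hd3 hL) 0 → Matrix (Fin 2) (Fin 2) ℂ)) {C₄ a₃ r e : ℝ}
          (_ : ∀ (Y : PBond (PV 2 ℓ m K hd3 hL) 0 → Matrix (Fin 2) (Fin 2) ℂ) (r' : ℝ), r' < a₃ → (∀ b, w 1 b * ‖Y b‖ ≤ r') →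
            (∀ (b : PBond (PV 2 ℓ m K hd3 hL) 0) (ν : Fin 3),
              w 2 b * (((ℓ + 1 : ℕ) : ℝ)) ^ (K - n) * ‖Y ⟨b.src.shift ν, b.dir⟩ - Y b‖ ≤ r') →
            ∀ b, w 3 b * ‖W Y b‖ ≤ C₄ * r' ^ 2)
          {A₁ 𝔄 : PBond (PV 2 ℓ m K hd3 hL) 0 → Matrix (Fin 2) (Fin 2) ℂ} (_ : A₁ + G (W (A₁ + 𝔄)) = 0) (_ : r < a₃)
          (_ : ∀ b, w 1 b * ‖(A₁ + 𝔄) b‖ ≤ r)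
          (_ : ∀ (b : PBond (PV 2 ℓ m K hd3 hL) 0) (ν : Fin 3),
            w 2 b * (((ℓ + 1 : ℕ) : ℝ)) ^ (K - n) * ‖(A₁ + 𝔄) ⟨b.src.shift ν, b.dir⟩ - (A₁ + 𝔄) b‖ ≤ r)
          (_ : ∀ φ : Matrix (Fin 2) (Fin 2) ℂ →ₗ[ℝ] ℝ,
            RE (cubeSeqMT3 (⟨ℓ + 1, hL, m, hm⟩ : T3Family) n K x₀ ρ S ((ℓ + 1) * Mh) hM1) ((((ℓ + 1 : ℕ) : ℝ)) ^ (K - n))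
              (dsE ((((ℓ + 1 : ℕ) : ℝ)) ^ (K - n)) (WithLp.toLp 2 (fun b => φ (A₁ b)))) = 0)
          (_ : B₀ * (C₄ * r ^ 2) ≤ e) (_ : (1 + BM) * (C₄ * r ^ 2) ≤ e),
          (∀ (z : B7Prop1Explicit.Site (PV 2 ℓ m K hd3 hL).d) (τ : Fin (PV 2 ℓ m K hd3 hL).d),
            SideTouches (pullDom (fun j => if K - n ≤ j then ({x₀} : Set (Site (PV 2 ℓ m K hd3 hL) 0)) else (∅ : Set (Site (PV 2 ℓ m K hd3 hL) 0))) (K - n)) z τ →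
            ‖A₁ ⟨transl 0 z, τ⟩‖ ≤ e) ∧
          (∀ (z : B7Prop1Explicit.Site (PV 2 ℓ m K hd3 hL).d) (κ τ : Fin (PV 2 ℓ m K hd3 hL).d),
            SideTouches (pullDom (fun j => if K - n ≤ j then ({x₀} : Set (Site (PV 2 ℓ m K hd3 hL) 0)) else (∅ : Set (Site (PV 2 ℓ m K hd3 hL) 0))) (K - n)) z τ →
            ‖(((((ℓ + 1 : ℕ) : ℝ))⁻¹) ^ (K - n))⁻¹ • (A₁ ⟨(transl 0 z).shift κ, τ⟩ - A₁ ⟨transl 0 z, τ⟩)‖ ≤ e) ∧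
          (∀ (z : B7Prop1Explicit.Site (PV 2 ℓ m K hd3 hL).d) (μ : Fin (PV 2 ℓ m K hd3 hL).d),
            BondTouches (pullDom (fun j => if K - n ≤ j then ({x₀} : Set (Site (PV 2 ℓ m K hd3 hL) 0)) else (∅ : Set (Site (PV 2 ℓ m K hd3 hL) 0))) (K - n)) z μ →
            ‖pdiv (((((ℓ + 1 : ℕ) : ℝ))⁻¹) ^ (K - n)) (1 : B7Prop1Explicit.Site (PV 2 ℓ m K hd3 hL).d → Fin (PV 2 ℓ m K hd3 hL).d → (Matrix (Fin 2) (Fin 2) ℂ)ˣ)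
                (plaqCovDeriv (((((ℓ + 1 : ℕ) : ℝ))⁻¹) ^ (K - n))
                  (1 : B7Prop1Explicit.Site (PV 2 ℓ m K hd3 hL).d → Fin (PV 2 ℓ m K hd3 hL).d → (Matrix (Fin 2) (Fin 2) ℂ)ˣ) (pull A₁ 0)) μ z‖ ≤ e) := by
  obtain ⟨Mh₀, R₀, B₀, δ₀, B₃, hδ₀, hB₃, hbody⟩ := body_of_adm22_allSizes_allL ℓ hL
  obtain ⟨Mh₀', R₀', CG, hCG, hband⟩ := gBand_of_adm22_allSizes_allL ℓ hL
  have hL0 : (0 : ℝ) ≤ (((ℓ + 1 : ℕ) : ℝ)) := by positivity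
  -- `B₀ ≥ 0` is forced at any admissible instance; export `max B₀ 0` and identify it inside
  refine ⟨max Mh₀ Mh₀', max (max R₀ R₀') 2, max B₀ 0, (max B₀ 0 * B₃ + 1) * (((ℓ + 1 : ℕ) : ℝ)) * CG, le_max_right _ _, by positivity, ?_⟩
  intro m hm n K hk1 hk' Mh R a' hMha hMh hR hM1 x₀ ρ S hRS hρ1 w hw
  have hnK : n < K := by omega
  set D := cubeSeqMT3 (⟨ℓ + 1, hL, m, hm⟩ : T3Family) n K x₀ ρ S ((ℓ + 1) * Mh) hM1 with hD
  have hAdm : Adm22 D R ((ℓ + 1) * Mh) := adm22_cubeSeqMT3 (⟨ℓ + 1, hL, m, hm⟩ : T3Family) n K x₀ ρ hM1 hRS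
  have hMh₀ : Mh₀ ≤ Mh := le_trans (le_max_left _ _) hMh
  have hMh₀' : Mh₀' ≤ Mh := le_trans (le_max_right _ _) hMh
  have hR₀ : R₀ ≤ R := le_trans (le_trans (le_max_left _ _) (le_max_left _ _)) hR
  have hR₀' : R₀' ≤ R := le_trans (le_trans (le_max_right _ _) (le_max_left _ _)) hR
  have hR2 : 2 ≤ R := le_trans (le_max_right _ _) hR
  have hRM : 2 * (⟨ℓ + 1, hL, m, hm⟩ : T3Family).L ≤ R * ((ℓ + 1) * Mh) := by
    show 2 * (ℓ + 1) ≤ R * ((ℓ + 1) * Mh)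
    calc 2 * (ℓ + 1) ≤ R * (ℓ + 1) := Nat.mul_le_mul_right _ hR2
      _ ≤ R * ((ℓ + 1) * Mh) := Nat.mul_le_mul_left _ (Nat.le_mul_of_pos_right _ (by rw [hMha]; positivity))
  -- P2's objects and letters at `D`
  obtain ⟨H, Gt, hFH, hFG, hHs, hGs, -, dBI, hdom, h162, hHd⟩ := hbody m hm n K hk1 hk' hMha hMh₀ hR₀ D rfl hAdm w hw
  have hB₀ : 0 ≤ B₀ := by
    have h := (hHs 0 1 zero_le_one (fun c => by simp)).1 ⟨x₀, ⟨0, by norm_num⟩⟩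
    simpa using h
  have hmax : max B₀ 0 = B₀ := max_eq_left hB₀
  -- the band `G`-row and the contraction row at `D`
  obtain ⟨w', hw', Ga, hGW, hGas, hwband⟩ := hband m hm n K hk1 hk' hMha hMh₀' hR₀' D rfl hAdm w hw
  have hQ := qContrLetter_of_adm22 (⟨ℓ + 1, hL, m, hm⟩ : T3Family) n K D rfl hAdm hRM w hw
  refine ⟨Gt, hFG, by rw [hmax]; exact hGs, ?_⟩
  intro G hGker W C₄ a₃ r e hWq A₁ 𝔄 hsol hr h1 h2 hslice he₁ he₂
  rw [hmax] at he₁ he₂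
  exact row165_of_slice (F := (⟨ℓ + 1, hL, m, hm⟩ : T3Family)) hnK x₀ ρ S ((ℓ + 1) * Mh) hM1 hρ1 hw hFH hHd h162 hdom hδ₀.le hB₀ hB₃.le
    hFG hGs hw' hGW hGas hwband hQ hCG hL0
    G hGker W hWq hsol hr h1 h2 hslice he₁ he₂

/-- ★ **THE (165)-A₁ ROW FROM THE TRACE PAIRING, EVERY ODD `L ≥ 3`, EVERY TORUS SIZE** (✓`row165_of_tracePairing_L5` with the binder `a′ + 3 ≤ m + n` deleted) — see the module docstring; `A₁ := A′ − 𝔄`, `𝔄(b) = Σ_c (He_c)(b)·(QA′)(c)` with P2's `flatH`; the three conjuncts are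
LITERALLY those of `HalvingA1Row165.row165_of_smallSolution_layer` for this `A₁` with bound `e ≥ max{B₀, 1 + B_M}·2C₄r²`.
[cite: Balaban1985Variational, (127)-(133) pp.297-298, (152)-(153) p.301, (158) p.302, (165) p.304; Balaban1984PropagatorsII, (2.1)-(2.2) p.224, Prop. 2.6 (2.136) p.247] -/
theorem row165_of_tracePairing_allSizes_allL (ℓ : ℕ) (hL : Odd (ℓ + 1) ∧ 1 < ℓ + 1) :
    ∃ (Mh₀ R₀ : ℕ) (B₀ BM : ℝ), 0 ≤ B₀ ∧ 0 ≤ BM ∧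
    ∀ (m : ℕ) (hm : 1 ≤ m) (n K : ℕ) (_ : 1 ≤ K - n) (_ : K - n + 1 ≤ m + K) {Mh R a' : ℕ} (_ : Mh = (ℓ + 1) ^ a') (_ : Mh₀ ≤ Mh) (_ : R₀ ≤ R)
      (hM1 : 1 ≤ (ℓ + 1) * Mh) (x₀ : Site (PV 2 ℓ m K hd3 hL) 0) (ρ S : ℕ) (_ : R * ((ℓ + 1) * Mh) ≤ S) (_ : 1 ≤ ρ)
      (w : ℕ → PBond (PV 2 ℓ m K hd3 hL) 0 → ℝ)
      (_ : IsLevWeight (⟨ℓ + 1, hL, m, hm⟩ : T3Family) n K (cubeSeqMT3 (⟨ℓ + 1, hL, m, hm⟩ : T3Family) n K x₀ ρ S ((ℓ + 1) * Mh) hM1) w)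
      (A' : PBond (PV 2 ℓ m K hd3 hL) 0 → Matrix (Fin 2) (Fin 2) ℂ) (_ : ∀ b, IsSelfAdjoint (A' b))
      (W₀ : (PBond (PV 2 ℓ m K hd3 hL) 0 → Matrix (Fin 2) (Fin 2) ℂ) → (PBond (PV 2 ℓ m K hd3 hL) 0 → Matrix (Fin 2) (Fin 2) ℂ))
      (_ : ∀ b, IsSelfAdjoint (W₀ A' b)) {C₄ a₃ r e : ℝ}
      (_ : ∀ (Y : PBond (PV 2 ℓ m K hd3 hL) 0 → Matrix (Fin 2) (Fin 2) ℂ) (r' : ℝ), r' < a₃ → (∀ b, w 1 b * ‖Y b‖ ≤ r') →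
        (∀ (b : PBond (PV 2 ℓ m K hd3 hL) 0) (ν : Fin 3), w 2 b * (((ℓ + 1 : ℕ) : ℝ)) ^ (K - n) * ‖Y ⟨b.src.shift ν, b.dir⟩ - Y b‖ ≤ r') →
        ∀ b, w 3 b * ‖W₀ Y b‖ ≤ C₄ * r' ^ 2)
      -- (i) the trace pairing on `ker Q`, self-adjoint test matrices
      (_ : ∀ s : PBond (PV 2 ℓ m K hd3 hL) 0 → ℝ, QE (cubeSeqMT3 (⟨ℓ + 1, hL, m, hm⟩ : T3Family) n K x₀ ρ S ((ℓ + 1) * Mh) hM1) (WithLp.toLp 2 s) = 0 →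
        ∀ E : Matrix (Fin 2) (Fin 2) ℂ, IsSelfAdjoint E →
        (((((((ℓ + 1 : ℕ) : ℝ)⁻¹) ^ (K - n) : ℝ) : ℂ) ^ 2 / 2) *
            ∑ p : Plaq (PV 2 ℓ m K hd3 hL) 0, Matrix.trace ((A' ⟨p.src, p.μ⟩ + A' ⟨p.src.shift p.μ, p.ν⟩ - A' ⟨p.src.shift p.ν, p.μ⟩ - A' ⟨p.src, p.ν⟩) *
              (((s ⟨p.src, p.μ⟩ : ℝ) : ℂ) • E + ((s ⟨p.src.shift p.μ, p.ν⟩ : ℝ) : ℂ) • E - ((s ⟨p.src.shift p.ν, p.μ⟩ : ℝ) : ℂ) • E -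
                ((s ⟨p.src, p.ν⟩ : ℝ) : ℂ) • E)) +
          (((((ℓ + 1 : ℕ) : ℝ)⁻¹) ^ (K - n) : ℝ) : ℂ) ^ 4 * ∑ b : PBond (PV 2 ℓ m K hd3 hL) 0, Matrix.trace (W₀ A' b * (((s b : ℝ) : ℂ) • E))).re = 0)
      -- (ii) the slice, per reading
      (_ : ∀ φ : Matrix (Fin 2) (Fin 2) ℂ →ₗ[ℝ] ℝ,
        RE (cubeSeqMT3 (⟨ℓ + 1, hL, m, hm⟩ : T3Family) n K x₀ ρ S ((ℓ + 1) * Mh) hM1) ((((ℓ + 1 : ℕ) : ℝ)) ^ (K - n))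
          (dsE ((((ℓ + 1 : ℕ) : ℝ)) ^ (K - n)) (WithLp.toLp 2 (fun b => φ (A' b)))) = 0)
      -- (iv) the (152) sizes of `A′`
      (_ : r < a₃) (_ : ∀ b, w 1 b * ‖A' b‖ ≤ r)
      (_ : ∀ (b : PBond (PV 2 ℓ m K hd3 hL) 0) (ν : Fin 3), w 2 b * (((ℓ + 1 : ℕ) : ℝ)) ^ (K - n) * ‖A' ⟨b.src.shift ν, b.dir⟩ - A' b‖ ≤ r)
      (_ : B₀ * (2 * C₄ * r ^ 2) ≤ e) (_ : (1 + BM) * (2 * C₄ * r ^ 2) ≤ e),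
      (∀ (z : B7Prop1Explicit.Site (PV 2 ℓ m K hd3 hL).d) (τ : Fin (PV 2 ℓ m K hd3 hL).d),
        SideTouches (pullDom (fun j => if K - n ≤ j then ({x₀} : Set (Site (PV 2 ℓ m K hd3 hL) 0)) else (∅ : Set (Site (PV 2 ℓ m K hd3 hL) 0))) (K - n)) z τ →
        ‖(A' - fun b : PBond (PV 2 ℓ m K hd3 hL) 0 => ∑ c, flatH (⟨ℓ + 1, hL, m, hm⟩ : T3Family) n K (cubeSeqMT3 (⟨ℓ + 1, hL, m, hm⟩ : T3Family) n K x₀ ρ S ((ℓ + 1) * Mh) hM1) (Pi.single c 1) b •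
            bondAvgIter (c.1.1 : ℕ) A' c.1.2) ⟨transl 0 z, τ⟩‖ ≤ e) ∧
      (∀ (z : B7Prop1Explicit.Site (PV 2 ℓ m K hd3 hL).d) (κ τ : Fin (PV 2 ℓ m K hd3 hL).d),
        SideTouches (pullDom (fun j => if K - n ≤ j then ({x₀} : Set (Site (PV 2 ℓ m K hd3 hL) 0)) else (∅ : Set (Site (PV 2 ℓ m K hd3 hL) 0))) (K - n)) z τ →
        ‖(((((ℓ + 1 : ℕ) : ℝ))⁻¹) ^ (K - n))⁻¹ •
          ((A' - fun b : PBond (PV 2 ℓ m K hd3 hL) 0 => ∑ c, flatH (⟨ℓ + 1, hL, m, hm⟩ : T3Family) n K (cubeSeqMT3 (⟨ℓ + 1, hL, m, hm⟩ : T3Family) n K x₀ ρ S ((ℓ + 1) * Mh) hM1) (Pi.single c 1) b •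
              bondAvgIter (c.1.1 : ℕ) A' c.1.2) ⟨(transl 0 z).shift κ, τ⟩ -
            (A' - fun b : PBond (PV 2 ℓ m K hd3 hL) 0 => ∑ c, flatH (⟨ℓ + 1, hL, m, hm⟩ : T3Family) n K (cubeSeqMT3 (⟨ℓ + 1, hL, m, hm⟩ : T3Family) n K x₀ ρ S ((ℓ + 1) * Mh) hM1) (Pi.single c 1) b •
              bondAvgIter (c.1.1 : ℕ) A' c.1.2) ⟨transl 0 z, τ⟩)‖ ≤ e) ∧
      (∀ (z : B7Prop1Explicit.Site (PV 2 ℓ m K hd3 hL).d) (μ : Fin (PV 2 ℓ m K hd3 hL).d),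
        BondTouches (pullDom (fun j => if K - n ≤ j then ({x₀} : Set (Site (PV 2 ℓ m K hd3 hL) 0)) else (∅ : Set (Site (PV 2 ℓ m K hd3 hL) 0))) (K - n)) z μ →
        ‖pdiv (((((ℓ + 1 : ℕ) : ℝ))⁻¹) ^ (K - n)) (1 : B7Prop1Explicit.Site (PV 2 ℓ m K hd3 hL).d → Fin (PV 2 ℓ m K hd3 hL).d → (Matrix (Fin 2) (Fin 2) ℂ)ˣ)
            (plaqCovDeriv (((((ℓ + 1 : ℕ) : ℝ))⁻¹) ^ (K - n))
              (1 : B7Prop1Explicit.Site (PV 2 ℓ m K hd3 hL).d → Fin (PV 2 ℓ m K hd3 hL).d → (Matrix (Fin 2) (Fin 2) ℂ)ˣ)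
              (pull (A' - fun b : PBond (PV 2 ℓ m K hd3 hL) 0 => ∑ c, flatH (⟨ℓ + 1, hL, m, hm⟩ : T3Family) n K (cubeSeqMT3 (⟨ℓ + 1, hL, m, hm⟩ : T3Family) n K x₀ ρ S ((ℓ + 1) * Mh) hM1)
                (Pi.single c 1) b • bondAvgIter (c.1.1 : ℕ) A' c.1.2) 0)) μ z‖ ≤ e) := by
  obtain ⟨Mh₀, R₀, B₀, BM, hB₀, hBM, hmain⟩ := row165_allSizes_allL ℓ hL
  refine ⟨Mh₀, R₀, B₀, BM, hB₀, hBM, ?_⟩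
  intro m hm n K hk1 hk' Mh R a' hMha hMh hR hM1 x₀ ρ S hRS hρ1 w hw A' hA' W₀ hW₀ C₄ a₃ r e hWq hpair hslice hr h1 h2 he₁ he₂
  obtain ⟨Gt, hGt, -, hrow⟩ := hmain m hm n K hk1 hk' hMha hMh hR hM1 x₀ ρ S hRS hρ1 w hw
  set F : T3Family := ⟨ℓ + 1, hL, m, hm⟩ with hF
  set D := cubeSeqMT3 F n K x₀ ρ S ((ℓ + 1) * Mh) hM1 with hD
  -- the `ℂ`-linear kernel extension of `G̃`
  let G : (PBond (PV 2 ℓ m K hd3 hL) 0 → Matrix (Fin 2) (Fin 2) ℂ) →ₗ[ℂ] (PBond (PV 2 ℓ m K hd3 hL) 0 → Matrix (Fin 2) (Fin 2) ℂ) :=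
    LinearMap.pi fun b => ∑ b', ((Gt (Pi.single b' 1) b : ℝ) : ℂ) • LinearMap.proj b'
  have hGker : ∀ (f : PBond (PV 2 ℓ m K hd3 hL) 0 → Matrix (Fin 2) (Fin 2) ℂ) (b : PBond (PV 2 ℓ m K hd3 hL) 0),
      G f b = ∑ b', Gt (Pi.single b' 1) b • f b' := by
    intro f b
    simp only [G, LinearMap.pi_apply, LinearMap.coe_sum, Finset.sum_apply, LinearMap.smul_apply, LinearMap.coe_proj, Function.eval,
      Complex.coe_smul]
  -- the `HB` of (157) and the solution of (158) from the trace pairing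
  set 𝔄 : PBond (PV 2 ℓ m K hd3 hL) 0 → Matrix (Fin 2) (Fin 2) ℂ := fun b => ∑ c, flatH F n K D (Pi.single c 1) b • bondAvgIter (c.1.1 : ℕ) A' c.1.2 with h𝔄
  have hsol158 := sol158_of_tracePairing (F := F) (n := n) (K := K) D hGt (𝔄 := 𝔄)
    (𝒢 := fun b => ∑ b', Gt (Pi.single b' 1) b • ((2 : ℝ) • W₀ A' b')) hA' hW₀ hpair hslice (fun _ => rfl) (fun _ => rfl)
  -- the current map `2•W₀` and its (98)
  have hsol : (A' - 𝔄) + G ((fun Y b => (2 : ℝ) • W₀ Y b) ((A' - 𝔄) + 𝔄)) = 0 := by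
    rw [sub_add_cancel]
    have hG𝒢 : G ((fun Y b => (2 : ℝ) • W₀ Y b) A') = fun b => ∑ b', Gt (Pi.single b' 1) b • ((2 : ℝ) • W₀ A' b') := by
      funext b
      exact hGker _ b
    rw [hG𝒢]
    exact hsol158
  have hWq2 : ∀ (Y : PBond (PV 2 ℓ m K hd3 hL) 0 → Matrix (Fin 2) (Fin 2) ℂ) (r' : ℝ), r' < a₃ → (∀ b, w 1 b * ‖Y b‖ ≤ r') →
      (∀ (b : PBond (PV 2 ℓ m K hd3 hL) 0) (ν : Fin 3), w 2 b * (((ℓ + 1 : ℕ) : ℝ)) ^ (K - n) * ‖Y ⟨b.src.shift ν, b.dir⟩ - Y b‖ ≤ r') →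
      ∀ b, w 3 b * ‖(fun Y b => (2 : ℝ) • W₀ Y b) Y b‖ ≤ (2 * C₄) * r' ^ 2 := by
    intro Y r' hr' hY1 hY2 b
    have h := hWq Y r' hr' hY1 hY2 b
    have h2 : ‖(2 : ℝ) • W₀ Y b‖ = 2 * ‖W₀ Y b‖ := by rw [norm_smul, Real.norm_of_nonneg (by norm_num : (0 : ℝ) ≤ 2)]
    show w 3 b * ‖(2 : ℝ) • W₀ Y b‖ ≤ 2 * C₄ * r' ^ 2
    rw [h2]
    nlinarith [h]
  -- the (152) sizes of `A₁ + 𝔄 = A′`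
  have h1' : ∀ b, w 1 b * ‖((A' - 𝔄) + 𝔄) b‖ ≤ r := fun b => by rw [sub_add_cancel]; exact h1 b
  have h2' : ∀ (b : PBond (PV 2 ℓ m K hd3 hL) 0) (ν : Fin 3),
      w 2 b * (((ℓ + 1 : ℕ) : ℝ)) ^ (K - n) * ‖((A' - 𝔄) + 𝔄) ⟨b.src.shift ν, b.dir⟩ - ((A' - 𝔄) + 𝔄) b‖ ≤ r := fun b ν => by
    rw [sub_add_cancel]; exact h2 b ν
  -- the slice transported from `A′` to `A₁ = A′ − 𝔄` (`𝔄` a kernel image of `flatH`)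
  have hslice' : ∀ φ : Matrix (Fin 2) (Fin 2) ℂ →ₗ[ℝ] ℝ,
      RE D ((((ℓ + 1 : ℕ) : ℝ)) ^ (K - n)) (dsE ((((ℓ + 1 : ℕ) : ℝ)) ^ (K - n)) (WithLp.toLp 2 (fun b => φ ((A' - 𝔄) b)))) = 0 :=
    HalvingELJunction.slice_of_decomp (F := F) (n := n) (K := K) D (A := A') (A₁ := A' - 𝔄) (𝔄 := 𝔄) (R := 0)
      (B := fun c => bondAvgIter (c.1.1 : ℕ) A' c.1.2) (B' := fun _ => 0) (by rw [sub_zero]; exact (sub_add_cancel A' 𝔄).symm) (fun _ => rfl)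
      (fun b => by simp) hslice
  exact hrow G hGker (fun Y b => (2 : ℝ) • W₀ Y b) hWq2 hsol hr h1' h2' hslice' he₁ he₂

/-- ★★ **THE (165)-A₁ ROW FROM THE 𝔰𝔲(2) TRACE PAIRING, EVERY ODD `L ≥ 3`, EVERY TORUS SIZE** (✓`row165_of_tracePairing_L5_su2` with the binder `a′ + 3 ≤ m + n` deleted) — ✓ `HalvingA1Row165TraceAnyW.row165_of_tracePairing_L5_anyW` with the chart field `A′`
bondwise TRACELESS and hypothesis (i) asked ONLY for traceless self-adjoint test matrices `E` (the tests an `SU(2)`-valued chart admits), smallness rows with `4C₄r²`; the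
three (165)-A₁ conjuncts VERBATIM for `A₁ := A′ − H(QA′)`. [cite: Balaban1985Variational, (99)-(100) p.293, (126)-(127) p.297, (152)-(153) p.301, (158) p.302, (165) p.304] -/
theorem row165_of_tracePairing_su2_allSizes_allL (ℓ : ℕ) (hL : Odd (ℓ + 1) ∧ 1 < ℓ + 1) :
    ∃ (Mh₀ R₀ : ℕ) (B₀ BM : ℝ), 0 ≤ B₀ ∧ 0 ≤ BM ∧
    ∀ (m : ℕ) (hm : 1 ≤ m) (n K : ℕ) (_ : 1 ≤ K - n) (_ : K - n + 1 ≤ m + K) {Mh R a' : ℕ} (_ : Mh = (ℓ + 1) ^ a') (_ : Mh₀ ≤ Mh) (_ : R₀ ≤ R)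
      (hM1 : 1 ≤ (ℓ + 1) * Mh) (x₀ : Site (PV 2 ℓ m K hd3 hL) 0) (ρ S : ℕ) (_ : R * ((ℓ + 1) * Mh) ≤ S) (_ : 1 ≤ ρ)
      (w : ℕ → PBond (PV 2 ℓ m K hd3 hL) 0 → ℝ)
      (_ : IsLevWeight (⟨ℓ + 1, hL, m, hm⟩ : T3Family) n K (cubeSeqMT3 (⟨ℓ + 1, hL, m, hm⟩ : T3Family) n K x₀ ρ S ((ℓ + 1) * Mh) hM1) w)
      (A' : PBond (PV 2 ℓ m K hd3 hL) 0 → Matrix (Fin 2) (Fin 2) ℂ) (_ : ∀ b, IsSelfAdjoint (A' b)) (_ : ∀ b, Matrix.trace (A' b) = 0)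
      (W₀ : (PBond (PV 2 ℓ m K hd3 hL) 0 → Matrix (Fin 2) (Fin 2) ℂ) → (PBond (PV 2 ℓ m K hd3 hL) 0 → Matrix (Fin 2) (Fin 2) ℂ)) {C₄ a₃ r e : ℝ}
      (_ : ∀ (Y : PBond (PV 2 ℓ m K hd3 hL) 0 → Matrix (Fin 2) (Fin 2) ℂ) (r' : ℝ), r' < a₃ → (∀ b, w 1 b * ‖Y b‖ ≤ r') →
        (∀ (b : PBond (PV 2 ℓ m K hd3 hL) 0) (ν : Fin 3), w 2 b * (((ℓ + 1 : ℕ) : ℝ)) ^ (K - n) * ‖Y ⟨b.src.shift ν, b.dir⟩ - Y b‖ ≤ r') →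
        ∀ b, w 3 b * ‖W₀ Y b‖ ≤ C₄ * r' ^ 2)
      (_ : ∀ s : PBond (PV 2 ℓ m K hd3 hL) 0 → ℝ, QE (cubeSeqMT3 (⟨ℓ + 1, hL, m, hm⟩ : T3Family) n K x₀ ρ S ((ℓ + 1) * Mh) hM1) (WithLp.toLp 2 s) = 0 →
        ∀ E : Matrix (Fin 2) (Fin 2) ℂ, IsSelfAdjoint E → Matrix.trace E = 0 →
        (((((((ℓ + 1 : ℕ) : ℝ)⁻¹) ^ (K - n) : ℝ) : ℂ) ^ 2 / 2) *
            ∑ p : Plaq (PV 2 ℓ m K hd3 hL) 0, Matrix.trace ((A' ⟨p.src, p.μ⟩ + A' ⟨p.src.shift p.μ, p.ν⟩ - A' ⟨p.src.shift p.ν, p.μ⟩ - A' ⟨p.src, p.ν⟩) *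
              (((s ⟨p.src, p.μ⟩ : ℝ) : ℂ) • E + ((s ⟨p.src.shift p.μ, p.ν⟩ : ℝ) : ℂ) • E - ((s ⟨p.src.shift p.ν, p.μ⟩ : ℝ) : ℂ) • E -
                ((s ⟨p.src, p.ν⟩ : ℝ) : ℂ) • E)) +
          (((((ℓ + 1 : ℕ) : ℝ)⁻¹) ^ (K - n) : ℝ) : ℂ) ^ 4 * ∑ b : PBond (PV 2 ℓ m K hd3 hL) 0, Matrix.trace (W₀ A' b * (((s b : ℝ) : ℂ) • E))).re = 0)
      (_ : ∀ φ : Matrix (Fin 2) (Fin 2) ℂ →ₗ[ℝ] ℝ,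
        RE (cubeSeqMT3 (⟨ℓ + 1, hL, m, hm⟩ : T3Family) n K x₀ ρ S ((ℓ + 1) * Mh) hM1) ((((ℓ + 1 : ℕ) : ℝ)) ^ (K - n))
          (dsE ((((ℓ + 1 : ℕ) : ℝ)) ^ (K - n)) (WithLp.toLp 2 (fun b => φ (A' b)))) = 0)
      (_ : r < a₃) (_ : ∀ b, w 1 b * ‖A' b‖ ≤ r)
      (_ : ∀ (b : PBond (PV 2 ℓ m K hd3 hL) 0) (ν : Fin 3), w 2 b * (((ℓ + 1 : ℕ) : ℝ)) ^ (K - n) * ‖A' ⟨b.src.shift ν, b.dir⟩ - A' b‖ ≤ r)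
      (_ : B₀ * (4 * C₄ * r ^ 2) ≤ e) (_ : (1 + BM) * (4 * C₄ * r ^ 2) ≤ e),
      (∀ (z : B7Prop1Explicit.Site (PV 2 ℓ m K hd3 hL).d) (τ : Fin (PV 2 ℓ m K hd3 hL).d),
        SideTouches (pullDom (fun j => if K - n ≤ j then ({x₀} : Set (Site (PV 2 ℓ m K hd3 hL) 0)) else (∅ : Set (Site (PV 2 ℓ m K hd3 hL) 0))) (K - n)) z τ →
        ‖(A' - fun b : PBond (PV 2 ℓ m K hd3 hL) 0 => ∑ c, flatH (⟨ℓ + 1, hL, m, hm⟩ : T3Family) n K (cubeSeqMT3 (⟨ℓ + 1, hL, m, hm⟩ : T3Family) n K x₀ ρ S ((ℓ + 1) * Mh) hM1) (Pi.single c 1) b •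
            bondAvgIter (c.1.1 : ℕ) A' c.1.2) ⟨transl 0 z, τ⟩‖ ≤ e) ∧
      (∀ (z : B7Prop1Explicit.Site (PV 2 ℓ m K hd3 hL).d) (κ τ : Fin (PV 2 ℓ m K hd3 hL).d),
        SideTouches (pullDom (fun j => if K - n ≤ j then ({x₀} : Set (Site (PV 2 ℓ m K hd3 hL) 0)) else (∅ : Set (Site (PV 2 ℓ m K hd3 hL) 0))) (K - n)) z τ →
        ‖(((((ℓ + 1 : ℕ) : ℝ))⁻¹) ^ (K - n))⁻¹ •
          ((A' - fun b : PBond (PV 2 ℓ m K hd3 hL) 0 => ∑ c, flatH (⟨ℓ + 1, hL, m, hm⟩ : T3Family) n K (cubeSeqMT3 (⟨ℓ + 1, hL, m, hm⟩ : T3Family) n K x₀ ρ S ((ℓ + 1) * Mh) hM1) (Pi.single c 1) b •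
              bondAvgIter (c.1.1 : ℕ) A' c.1.2) ⟨(transl 0 z).shift κ, τ⟩ -
            (A' - fun b : PBond (PV 2 ℓ m K hd3 hL) 0 => ∑ c, flatH (⟨ℓ + 1, hL, m, hm⟩ : T3Family) n K (cubeSeqMT3 (⟨ℓ + 1, hL, m, hm⟩ : T3Family) n K x₀ ρ S ((ℓ + 1) * Mh) hM1) (Pi.single c 1) b •
              bondAvgIter (c.1.1 : ℕ) A' c.1.2) ⟨transl 0 z, τ⟩)‖ ≤ e) ∧
      (∀ (z : B7Prop1Explicit.Site (PV 2 ℓ m K hd3 hL).d) (μ : Fin (PV 2 ℓ m K hd3 hL).d),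
        BondTouches (pullDom (fun j => if K - n ≤ j then ({x₀} : Set (Site (PV 2 ℓ m K hd3 hL) 0)) else (∅ : Set (Site (PV 2 ℓ m K hd3 hL) 0))) (K - n)) z μ →
        ‖pdiv (((((ℓ + 1 : ℕ) : ℝ))⁻¹) ^ (K - n)) (1 : B7Prop1Explicit.Site (PV 2 ℓ m K hd3 hL).d → Fin (PV 2 ℓ m K hd3 hL).d → (Matrix (Fin 2) (Fin 2) ℂ)ˣ)
            (plaqCovDeriv (((((ℓ + 1 : ℕ) : ℝ))⁻¹) ^ (K - n))
              (1 : B7Prop1Explicit.Site (PV 2 ℓ m K hd3 hL).d → Fin (PV 2 ℓ m K hd3 hL).d → (Matrix (Fin 2) (Fin 2) ℂ)ˣ)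
              (pull (A' - fun b : PBond (PV 2 ℓ m K hd3 hL) 0 => ∑ c, flatH (⟨ℓ + 1, hL, m, hm⟩ : T3Family) n K (cubeSeqMT3 (⟨ℓ + 1, hL, m, hm⟩ : T3Family) n K x₀ ρ S ((ℓ + 1) * Mh) hM1)
                (Pi.single c 1) b • bondAvgIter (c.1.1 : ℕ) A' c.1.2) 0)) μ z‖ ≤ e) := by
  obtain ⟨Mh₀, R₀, B₀, BM, hB₀, hBM, hmain⟩ := row165_of_tracePairing_allSizes_allL ℓ hL
  refine ⟨Mh₀, R₀, B₀, BM, hB₀, hBM, ?_⟩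
  intro m hm n K hk1 hk' Mh R a' hMha hMh hR hM1 x₀ ρ S hRS hρ1 w hw A' hA' hA'tr W₀ C₄ a₃ r e hWq hpair hslice hr h1 h2 he₁ he₂
  -- the traceless self-adjoint part of the current
  refine hmain m hm n K hk1 hk' hMha hMh hR hM1 x₀ ρ S hRS hρ1 w hw A' hA'
    (fun Y b => (1 / 2 : ℝ) • (W₀ Y b + (W₀ Y b)ᴴ) - (Matrix.trace ((1 / 2 : ℝ) • (W₀ Y b + (W₀ Y b)ᴴ)) / 2) • (1 : Matrix (Fin 2) (Fin 2) ℂ))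
    (fun b => isSelfAdjoint_sub_halfTrace (isSelfAdjoint_hermPart (W₀ A' b))) (C₄ := 2 * C₄)
    (fun Y r' hr' hY1 hY2 b => ?_) (fun s hs E hE => ?_) hslice hr h1 h2 (by linarith) (by linarith)
  · -- (98) for the traceless self-adjoint part: `‖M♮‖ ≤ 2‖½(M + Mᴴ)‖ ≤ 2‖M‖`
    have h := hWq Y r' hr' hY1 hY2 b
    have hw3 : 0 ≤ w 3 b := by rw [hw 3 b]; positivity
    calc w 3 b * ‖(1 / 2 : ℝ) • (W₀ Y b + (W₀ Y b)ᴴ) - (Matrix.trace ((1 / 2 : ℝ) • (W₀ Y b + (W₀ Y b)ᴴ)) / 2) • (1 : Matrix (Fin 2) (Fin 2) ℂ)‖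
        ≤ w 3 b * (2 * ‖W₀ Y b‖) := by
          refine mul_le_mul_of_nonneg_left ((norm_sub_halfTrace_le _).trans ?_) hw3
          exact mul_le_mul_of_nonneg_left (norm_hermPart_le (W₀ Y b)) (by norm_num)
      _ = 2 * (w 3 b * ‖W₀ Y b‖) := by ring
      _ ≤ 2 * (C₄ * r' ^ 2) := mul_le_mul_of_nonneg_left h (by norm_num)
      _ = 2 * C₄ * r' ^ 2 := by ring
  · -- the pairing of `(A′, W♮)` against `s•E`, `E` self-adjoint: reduce to the traceless test `E₀ = E − ½(tr E)·1` and the current `W₀`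
    set E₀ : Matrix (Fin 2) (Fin 2) ℂ := E - (Matrix.trace E / 2) • (1 : Matrix (Fin 2) (Fin 2) ℂ) with hE₀
    have hE₀sa : IsSelfAdjoint E₀ := isSelfAdjoint_sub_halfTrace hE
    have hE₀tr : Matrix.trace E₀ = 0 := trace_sub_halfTrace E
    have h := hpair s hs E₀ hE₀sa hE₀tr
    -- split the real part of the pairing (as in `row165_of_tracePairing_L5_anyW`)
    have key : ∀ (X : PBond (PV 2 ℓ m K hd3 hL) 0 → Matrix (Fin 2) (Fin 2) ℂ) (E' : Matrix (Fin 2) (Fin 2) ℂ),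
        (((((((ℓ + 1 : ℕ) : ℝ)⁻¹) ^ (K - n) : ℝ) : ℂ) ^ 2 / 2) *
            ∑ p : Plaq (PV 2 ℓ m K hd3 hL) 0, Matrix.trace ((A' ⟨p.src, p.μ⟩ + A' ⟨p.src.shift p.μ, p.ν⟩ - A' ⟨p.src.shift p.ν, p.μ⟩ - A' ⟨p.src, p.ν⟩) *
              (((s ⟨p.src, p.μ⟩ : ℝ) : ℂ) • E' + ((s ⟨p.src.shift p.μ, p.ν⟩ : ℝ) : ℂ) • E' - ((s ⟨p.src.shift p.ν, p.μ⟩ : ℝ) : ℂ) • E' -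
                ((s ⟨p.src, p.ν⟩ : ℝ) : ℂ) • E')) +
          (((((ℓ + 1 : ℕ) : ℝ)⁻¹) ^ (K - n) : ℝ) : ℂ) ^ 4 * ∑ b : PBond (PV 2 ℓ m K hd3 hL) 0, Matrix.trace (X b * (((s b : ℝ) : ℂ) • E'))).re =
        (((((((ℓ + 1 : ℕ) : ℝ)⁻¹) ^ (K - n) : ℝ) : ℂ) ^ 2 / 2) *
            ∑ p : Plaq (PV 2 ℓ m K hd3 hL) 0, Matrix.trace ((A' ⟨p.src, p.μ⟩ + A' ⟨p.src.shift p.μ, p.ν⟩ - A' ⟨p.src.shift p.ν, p.μ⟩ - A' ⟨p.src, p.ν⟩) *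
              (((s ⟨p.src, p.μ⟩ : ℝ) : ℂ) • E' + ((s ⟨p.src.shift p.μ, p.ν⟩ : ℝ) : ℂ) • E' - ((s ⟨p.src.shift p.ν, p.μ⟩ : ℝ) : ℂ) • E' -
                ((s ⟨p.src, p.ν⟩ : ℝ) : ℂ) • E'))).re +
          ((((ℓ + 1 : ℕ) : ℝ)⁻¹) ^ (K - n)) ^ 4 * ∑ b : PBond (PV 2 ℓ m K hd3 hL) 0, (Matrix.trace (X b * (((s b : ℝ) : ℂ) • E'))).re := by
      intro X E'
      rw [Complex.add_re]
      congr 1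
      rw [Complex.mul_re, ← Complex.ofReal_pow, Complex.ofReal_re, Complex.ofReal_im, zero_mul, sub_zero, Complex.re_sum]
    rw [key] at h ⊢
    -- the test `s•E` against a traceless matrix may be replaced by `s•E₀`
    have htest : ∀ (M : Matrix (Fin 2) (Fin 2) ℂ), Matrix.trace M = 0 → ∀ (a b c d : ℝ),
        Matrix.trace (M * (((a : ℝ) : ℂ) • E + ((b : ℝ) : ℂ) • E - ((c : ℝ) : ℂ) • E - ((d : ℝ) : ℂ) • E)) =
          Matrix.trace (M * (((a : ℝ) : ℂ) • E₀ + ((b : ℝ) : ℂ) • E₀ - ((c : ℝ) : ℂ) • E₀ - ((d : ℝ) : ℂ) • E₀)) := by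
      intro M hM a b c d
      have hsplit : E = E₀ + (Matrix.trace E / 2) • (1 : Matrix (Fin 2) (Fin 2) ℂ) := by rw [hE₀]; abel
      have hcomb : ∀ F : Matrix (Fin 2) (Fin 2) ℂ, ((a : ℝ) : ℂ) • F + ((b : ℝ) : ℂ) • F - ((c : ℝ) : ℂ) • F - ((d : ℝ) : ℂ) • F =
          (((a : ℝ) : ℂ) + ((b : ℝ) : ℂ) - ((c : ℝ) : ℂ) - ((d : ℝ) : ℂ)) • F := by
        intro F; simp only [add_smul, sub_smul]
      rw [hcomb, hcomb]
      conv_lhs => rw [hsplit, smul_add, Matrix.mul_add, Matrix.trace_add, trace_mul_smul_smul_one_eq_zero hM, add_zero]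
    -- plaquette term: `tr Φ_p(A′) = 0`
    have hΦ : ∀ p : Plaq (PV 2 ℓ m K hd3 hL) 0,
        Matrix.trace (A' ⟨p.src, p.μ⟩ + A' ⟨p.src.shift p.μ, p.ν⟩ - A' ⟨p.src.shift p.ν, p.μ⟩ - A' ⟨p.src, p.ν⟩) = 0 := by
      intro p
      rw [Matrix.trace_sub, Matrix.trace_sub, Matrix.trace_add, hA'tr, hA'tr, hA'tr, hA'tr]
      ring
    have hterm1 : ∀ p : Plaq (PV 2 ℓ m K hd3 hL) 0,
        Matrix.trace ((A' ⟨p.src, p.μ⟩ + A' ⟨p.src.shift p.μ, p.ν⟩ - A' ⟨p.src.shift p.ν, p.μ⟩ - A' ⟨p.src, p.ν⟩) *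
          (((s ⟨p.src, p.μ⟩ : ℝ) : ℂ) • E + ((s ⟨p.src.shift p.μ, p.ν⟩ : ℝ) : ℂ) • E - ((s ⟨p.src.shift p.ν, p.μ⟩ : ℝ) : ℂ) • E -
            ((s ⟨p.src, p.ν⟩ : ℝ) : ℂ) • E)) =
        Matrix.trace ((A' ⟨p.src, p.μ⟩ + A' ⟨p.src.shift p.μ, p.ν⟩ - A' ⟨p.src.shift p.ν, p.μ⟩ - A' ⟨p.src, p.ν⟩) *
          (((s ⟨p.src, p.μ⟩ : ℝ) : ℂ) • E₀ + ((s ⟨p.src.shift p.μ, p.ν⟩ : ℝ) : ℂ) • E₀ - ((s ⟨p.src.shift p.ν, p.μ⟩ : ℝ) : ℂ) • E₀ -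
            ((s ⟨p.src, p.ν⟩ : ℝ) : ℂ) • E₀)) := fun p => htest _ (hΦ p) _ _ _ _
    -- bond term: `Re tr(W♮·(sE)) = Re tr(W♮·(sE₀)) = Re tr(½(W+Wᴴ)·(sE₀)) = Re tr(W·(sE₀))`
    have hterm2 : ∀ b : PBond (PV 2 ℓ m K hd3 hL) 0,
        (Matrix.trace (((1 / 2 : ℝ) • (W₀ A' b + (W₀ A' b)ᴴ) - (Matrix.trace ((1 / 2 : ℝ) • (W₀ A' b + (W₀ A' b)ᴴ)) / 2) • (1 : Matrix (Fin 2) (Fin 2) ℂ)) *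
          (((s b : ℝ) : ℂ) • E))).re = (Matrix.trace (W₀ A' b * (((s b : ℝ) : ℂ) • E₀))).re := by
      intro b
      have hsplit : ((s b : ℝ) : ℂ) • E = ((s b : ℝ) : ℂ) • E₀ + ((s b : ℝ) : ℂ) • ((Matrix.trace E / 2) • (1 : Matrix (Fin 2) (Fin 2) ℂ)) := by
        rw [← smul_add, hE₀, sub_add_cancel]
      rw [hsplit, Matrix.mul_add, Matrix.trace_add, trace_mul_smul_smul_one_eq_zero (trace_sub_halfTrace _), add_zero,
        re_trace_sub_halfTrace_mul _ _ hE₀tr, re_trace_mul_eq_hermPart (W₀ A' b) E₀ hE₀sa (s b)]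
    simp only [hterm1, hterm2]
    exact h

end Summit.QuantumFields.YangMills.Theorems.HalvingA1Row165AllSizesAllL

end
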